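import Mathlib
import HarnessLib
import Summits.HubbardSuperconductivity.HubbardSuperconductivity.Theses.KLProgramme
import Summits.HubbardSuperconductivity.HubbardSuperconductivity.Theorems.KLProgrammeKLRegimeSplitGlueV7P3

/-!
# Route `KLProgramme` — closer of the K3 glue item `KLRegimeTwoPointLimitGlueV7` (stmt-HubbardSuperconductivity-19667)

Cell gate-hubbard-kl, seat p2 (g5).  The route file's gen-2 glue statement
`KLRegimeEngineV7 → KLRegimeBetaSplitV7 → KLRegimeCountertermV7 → KLRegimeVolumeLimitV7 → KLRegimeTwoPointAssemblyV7 → KLRegimeTwoPointLimit`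
(K3 resplit rev 10/11; children = `EngineP3 / BetaSplitP / CountertermP2 klPredsV7 klWindowC`,
`VolumeLimitP / TwoPointAssemblyP3 klPredsV7 FinalTwoLegVolLimit klWindowC` by definition) IS the glued strong induction
`…KLRegimeSplit.KLRegimeInductionV7P3 = KLRegimeInductionP3 klPredsV7 FinalTwoLegVolLimit` (p450921,
`KLProgrammeKLRegimeSplitGlueV7P3.lean`): the children unfold definitionally.  One line; nothing new is asserted.
-/

namespace Summit.HubbardSuperconductivity.HubbardSuperconductivity.Theorems

set_option linter.dupNamespace false -- summit = problem name (single-conjunct summit), D-0017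

/-- **The gen-2 K3 glue holds**: the five V7 children of the split imply `KLRegimeTwoPointLimit`
(by `KLRegimeSplit.KLRegimeInductionV7P3`). -/
theorem klRegimeTwoPointLimitGlueV7_proof :
    Summit.HubbardSuperconductivity.HubbardSuperconductivity.Theses.KLProgramme.KLRegimeTwoPointLimitGlueV7 :=
  fun h₁ h₂ h₃ h₄ h₅ => KLRegimeSplit.KLRegimeInductionV7P3 h₁ h₂ h₃ h₄ h₅

end Summit.HubbardSuperconductivity.HubbardSuperconductivity.Theorems
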